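import Mathlib.Analysis.SpecialFunctions.Pow.Real
import Mathlib.Analysis.SpecialFunctions.Complex.Log
import Literature.NumberTheory.Transcendental.ExpDominantSolvabilityContraction
import Literature.NumberTheory.Transcendental.ExpVarieties
import Literature.ModelTheory.ExponentialFields.Languages
import Summits.Schanuel.Schanuel.Theorems.ZilberEacComplexPunctureDecouplingLemmas
import Summits.Schanuel.Schanuel.Theorems.ZilberEacComplexGraphEscapeLemmas
import HarnessLib

/-!
# EC by escape to infinity over graph bases of ARBITRARY degree (no lattice-direction hypothesis)

Zilber's Exponential-Algebraic Closedness, range `dim π₁(V) = n - 1` (first open rung, Mantova–Masser,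
PLMS 129 (2024), §1 p. 5), by the escape mechanism, for the `(s+1)`-folds

  `V = {x_{s+1} = g(x'), yⱼ = cⱼ y_{s+1}^{κⱼ} + Σ_{i<κⱼ} A_{j,i}(x') y_{s+1}^i (j ≤ s)}`

over the graph of ANY polynomial `g ∈ ℂ[x₁..xₛ]` of total degree `D ≥ 2` — every fibre polynomial in
`(x', y_{s+1})` of `y_{s+1}`-degree `κⱼ ≥ 1` with constant non-zero top coefficient — under the single
non-degeneracy condition `g_D(κ) ≠ 0` on the leading form. The quadric case `D = 2`
(`g_D(κ) = κᵀMκ`) is `ZilberEacComplexQuadricEscape{Matrix,Powers,Laurent}.lean`; degree `D ≥ 3` was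
listed open in this packet's census ("escape for deg g ≥ 3: needs a holomorphic root branch").

NEW MECHANISM (no root branch needed): the escaping coordinate is an UNKNOWN of the fixed-point
problem. With `α = g_D(κ)`, a sign `σ = ±1` and `τ₀ = r e^{iθ₀}`, `|θ₀| ≤ π/(2D)`, `α τ₀ᴰ = 2πiσk`
(`rᴰ = 2πk/‖α‖`), put `τ = τ₀ e^{η/D}`, `xⱼ = κⱼτ + log cⱼ + ζⱼ`, and solve on the unit polydisc of
`ℂ^{s+1} ∋ (ζ, η)` the system
  `e^{ζⱼ} = 1 + Σᵢ A_{j,i}(x) e^{-(κⱼ-i)τ}/cⱼ`,   `e^{η} = 1 + (τ + ατᴰ - g(x))/(2πiσk)`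
by the contraction lemma `Literature.NumberTheory.Transcendental.ExpDominant.exists_exp_eq_one_add`:
the last equation says exactly `g(x) = τ + 2πiσk`, and its right side is `O(k^{-1/D})` by the ray
expansion `g(τκ + w) = ατᴰ + O(‖τ‖^{D-1})` (`ZilberEacComplexGraphEscapeLemmas.lean`), while
`Re τ ≥ r/12` makes the fibre perturbations exponentially small.

* `exists_expPoint_graphEscape` — **EC for the class above** (Theorem E_D);
* `exists_expPoint_graphEscape_powers` — monomial fibres `yⱼ = cⱼ y_{s+1}^{κⱼ} + Aⱼ(x')`
  (EC vocabulary and model systems: `ZilberEacComplexGraphEscapeExamples.lean`).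

HONEST FRAMING: a modest new sub-rung of EAC; nothing here bears on Schanuel's conjecture.
-/

noncomputable section

open Complex MvPolynomial Metric Set Filter Topology

set_option linter.dupNamespace false

namespace Summit.Schanuel.Schanuel.Theorems

/-! ### The escape theorem of arbitrary degree -/

set_option maxHeartbeats 800000 in
/-- **EC by escape to infinity over a graph base of arbitrary degree (Theorem E_D).** Let
`g ∈ ℂ[x₁..xₛ]` have total degree `D ≥ 2` and leading form `g_D`, let `κⱼ ∈ ℕ` with
`g_D(κ) ≠ 0`, `cⱼ ∈ ℂˣ`, and `A_{j,i} ∈ ℂ[x₁..xₛ]` (`i < κⱼ`) arbitrary. Then the system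
`exp xⱼ = cⱼ (e^{g(x)})^{κⱼ} + Σ_{i<κⱼ} A_{j,i}(x) (e^{g(x)})^i` (`j ≤ s`) has a solution `x ∈ ℂˢ`:
the `(s+1)`-fold `V = {x_{s+1} = g(x'), yⱼ = cⱼ y_{s+1}^{κⱼ} + Σ_{i<κⱼ} A_{j,i}(x') y_{s+1}^i}` —
additive projection the graph hypersurface `x_{s+1} = g(x')`, `dim π₁ V = n - 1`, first open range of
Exponential-Algebraic Closedness (Mantova–Masser 2024 §1 p. 5) — meets the graph of `exp`, with NO
hypothesis on lattice directions and NO restriction on the degree. Mechanism: all coordinates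
escape to infinity, `xⱼ = κⱼτ + log cⱼ + ζⱼ`, `x_{s+1} = τ + 2πiσk`, `Re τ ≍ k^{1/D}`, the escaping
coordinate `τ = τ₀e^{η/D}` being itself an unknown of the contraction. Generalizes the quadric escape
theorems (`D = 2`). New. [cite: MantovaMasser2023, §1 p.5 (the open case dim π(V) = 2 in ℂ³×ℂˣ³)] -/
theorem exists_expPoint_graphEscape {s : ℕ} (g : MvPolynomial (Fin s) ℂ) (hD : 2 ≤ g.totalDegree)
    (κ : Fin s → ℕ) (hα : eval (fun j => (κ j : ℂ)) (homogeneousComponent g.totalDegree g) ≠ 0)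
    (c : Fin s → ℂ) (hc : ∀ j, c j ≠ 0) (A : Fin s → ℕ → MvPolynomial (Fin s) ℂ) :
    ∃ x : Fin s → ℂ, ∀ j,
      exp (x j) = c j * exp (eval x g) ^ (κ j) +
        ∑ i ∈ Finset.range (κ j), eval x (A j i) * exp (eval x g) ^ i := by
  classical
  -- ### notation and constants
  set D := g.totalDegree with hDdef
  set κc : Fin s → ℂ := fun j => (κ j : ℂ) with hκc
  set α : ℂ := eval κc (homogeneousComponent D g) with hαdef
  have hα0 : α ≠ 0 := hα
  have hαpos : 0 < ‖α‖ := norm_pos_iff.mpr hα0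
  have hD0 : D ≠ 0 := by omega
  have hDpos : 0 < D := by omega
  have hDC : (D : ℂ) ≠ 0 := by exact_mod_cast hD0
  set ℓ : Fin s → ℂ := fun j => log (c j) with hℓ
  have hexpℓ : ∀ j, exp (ℓ j) = c j := fun j => Complex.exp_log (hc j)
  obtain ⟨σ, hσ, θ₀, hθ₀, hroot⟩ := exists_sign_arg_root hα0 hDpos
  have hσabs : |σ| = 1 := by rcases hσ with h | h <;> simp [h]
  obtain ⟨Cg, hCg0, Ng, hCg⟩ := exists_norm_eval_ray_sub_le g κc
  have hgrowth := fun j i =>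
    Literature.NumberTheory.Transcendental.HypersurfaceCover.exists_norm_eval_le_pow (A j i)
  choose CA hCA0 NA hCA using hgrowth
  set ε : ℝ := 1 / (16 * ((s : ℝ) + 2)) with hε
  have hεpos : 0 < ε := by positivity
  set L : ℝ := 2 * ‖κc‖ + ‖ℓ‖ + 2 with hL
  have hL0 : 0 ≤ L := by positivity
  -- ### the size `r` of the escaping coordinate: conditions holding for all large `r`
  set F : Fin s → ℝ → ℝ := fun j r =>
    (∑ i ∈ Finset.range (κ j), CA j i * L ^ NA j i * ((1 + r) ^ NA j i * Real.exp (-(r / 12)))) /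
      ‖c j‖ with hF
  have hFt : ∀ j, Tendsto (F j) atTop (𝓝 0) := by
    intro j
    have h1 := tendsto_finsetSum (Finset.range (κ j)) fun i _ =>
      (tendsto_one_add_pow_mul_exp_neg_div (NA j i)).const_mul (CA j i * L ^ NA j i)
    simp only [mul_zero, Finset.sum_const_zero] at h1
    have h2 := h1.div_const ‖c j‖
    rw [zero_div] at h2
    exact h2
  set R₃ : ℝ := (2 + Cg * (2 + ‖ℓ‖) ^ Ng * 2 ^ (D - 1)) / (‖α‖ * ε) with hR₃
  have hev : ∀ᶠ r : ℝ in atTop, (∀ j, F j r ≤ ε) ∧ max 2 R₃ ≤ r := by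
    refine (eventually_all.2 fun j => ?_).and (eventually_ge_atTop _)
    exact (hFt j).eventually (ge_mem_nhds hεpos)
  obtain ⟨R, hR⟩ := Filter.eventually_atTop.mp hev
  -- ### choice of `k` and `r = (2πk/‖α‖)^{1/D} ≥ R`
  obtain ⟨k, hk0, hkR⟩ : ∃ k : ℕ, 0 < k ∧ max R 0 ^ D ≤ 2 * Real.pi * k / ‖α‖ := by
    refine ⟨⌈‖α‖ * max R 0 ^ D / (2 * Real.pi)⌉₊ + 1, Nat.succ_pos _, ?_⟩
    rw [le_div_iff₀ hαpos]
    have h1 := Nat.le_ceil (‖α‖ * max R 0 ^ D / (2 * Real.pi))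
    have h2 : ‖α‖ * max R 0 ^ D / (2 * Real.pi) * (2 * Real.pi) = ‖α‖ * max R 0 ^ D := by
      field_simp
    have h3 := mul_le_mul_of_nonneg_right h1 (by positivity : (0 : ℝ) ≤ 2 * Real.pi)
    rw [h2] at h3
    push_cast
    nlinarith [Real.pi_pos, h3]
  set r : ℝ := (2 * Real.pi * k / ‖α‖) ^ ((D : ℝ)⁻¹) with hr
  have hbase : 0 ≤ 2 * Real.pi * k / ‖α‖ := by positivity
  have hr0 : 0 ≤ r := Real.rpow_nonneg hbase _
  have hrD : r ^ D = 2 * Real.pi * k / ‖α‖ := Real.rpow_inv_natCast_pow hbase hD0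
  have hRr : R ≤ r := by
    have h1 : max R 0 ≤ r := by
      have := Real.rpow_le_rpow (by positivity) hkR (inv_nonneg.mpr (Nat.cast_nonneg D))
      rwa [Real.pow_rpow_inv_natCast (le_max_right _ _) hD0] at this
    exact (le_max_left _ _).trans h1
  obtain ⟨hFε, hmax⟩ := hR r hRr
  have hr2 : 2 ≤ r := (le_max_left _ _).trans hmax
  have hR₃r : R₃ ≤ r := (le_max_right _ _).trans hmax
  have hrpos : 0 < r := by linarith
  have hr1 : 1 ≤ r := by linarith
  -- ### the base point `τ₀ = r e^{iθ₀}` and the lattice constant `K₀ = α τ₀ᴰ = 2πiσk`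
  set τ₀ : ℂ := (r : ℂ) * exp (θ₀ * I) with hτ₀
  set K₀ : ℂ := ((2 * Real.pi * k * σ : ℝ) : ℂ) * I with hK₀
  have hK₀eq : α * τ₀ ^ D = K₀ := by
    have hαC : ((‖α‖ : ℝ) : ℂ) ≠ 0 := by exact_mod_cast hαpos.ne'
    have h1 : (r : ℂ) ^ D = ((2 * Real.pi * k / ‖α‖ : ℝ) : ℂ) := by
      rw [← Complex.ofReal_pow, hrD]
    calc α * τ₀ ^ D = (r : ℂ) ^ D * (α * exp (θ₀ * I) ^ D) := by rw [hτ₀, mul_pow]; ring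
      _ = ((2 * Real.pi * k / ‖α‖ : ℝ) : ℂ) * (I * σ * ‖α‖) := by rw [h1, hroot]
      _ = K₀ := by
          rw [hK₀]
          push_cast
          rw [div_mul_eq_mul_div, div_eq_iff hαC]
          ring
  have hK₀norm : ‖K₀‖ = 2 * Real.pi * k := by
    rw [hK₀, norm_mul, Complex.norm_I, mul_one, Complex.norm_real, Real.norm_eq_abs, abs_mul,
      hσabs, mul_one, abs_of_nonneg (by positivity)]
  have hK₀norm' : ‖K₀‖ = ‖α‖ * r ^ D := by
    rw [hK₀norm, hrD]; field_simp
  have hK₀pos : 0 < ‖K₀‖ := by rw [hK₀norm]; positivity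
  have hK₀0 : K₀ ≠ 0 := norm_pos_iff.mp hK₀pos
  have hexpK₀ : exp K₀ = 1 := by
    rcases hσ with h | h
    · rw [hK₀, h, show (((2 * Real.pi * k * (1 : ℝ) : ℝ) : ℂ) * I) = (k : ℂ) * (2 * Real.pi * I) by
        push_cast; ring]
      exact Complex.exp_nat_mul_two_pi_mul_I k
    · rw [hK₀, h, show (((2 * Real.pi * k * (-1 : ℝ) : ℝ) : ℂ) * I) = -((k : ℂ) * (2 * Real.pi * I))
        by push_cast; ring, Complex.exp_neg, Complex.exp_nat_mul_two_pi_mul_I, inv_one]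
  -- ### the maps of the fixed-point problem on `ℂ^{s+1} ∋ ξ = (ζ, η)`
  set τf : (Fin (s + 1) → ℂ) → ℂ := fun ξ => τ₀ * exp (ξ (Fin.last s) * (D : ℂ)⁻¹) with hτf
  set xf : (Fin (s + 1) → ℂ) → (Fin s → ℂ) := fun ξ => τf ξ • κc + (ℓ + Fin.init ξ) with hxf
  set Gj : Fin s → (Fin (s + 1) → ℂ) → ℂ := fun j ξ =>
    (∑ i ∈ Finset.range (κ j), eval (xf ξ) (A j i) *
      exp (-(((κ j - i : ℕ) : ℂ) * τf ξ))) * (c j)⁻¹ with hGj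
  set Gl : (Fin (s + 1) → ℂ) → ℂ := fun ξ =>
    (τf ξ + α * τf ξ ^ D - eval (xf ξ) g) * K₀⁻¹ with hGl
  set G : Fin (s + 1) → (Fin (s + 1) → ℂ) → ℂ :=
    Fin.snoc (α := fun _ => (Fin (s + 1) → ℂ) → ℂ) Gj Gl with hG
  -- ### differentiability
  have hτf_diff : Differentiable ℂ τf := by
    have h1 : Differentiable ℂ (fun ξ : Fin (s + 1) → ℂ => ξ (Fin.last s)) :=
      differentiable_apply _
    have h2 := ((h1.mul_const ((D : ℂ)⁻¹)).cexp).const_mul τ₀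
    exact h2
  have hxf_diff : ∀ i, Differentiable ℂ fun ξ => xf ξ i := by
    intro i
    have h1 : Differentiable ℂ (fun ξ : Fin (s + 1) → ℂ => ξ (Fin.castSucc i)) :=
      differentiable_apply _
    have h2 := (hτf_diff.mul_const (κc i)).add ((differentiable_const (ℓ i)).add h1)
    exact h2
  have heval_diff : ∀ p : MvPolynomial (Fin s) ℂ, Differentiable ℂ fun ξ => eval (xf ξ) p :=
    fun p ξ => DifferentiableAt.mvPolynomial_eval p fun i => (hxf_diff i) ξ
  have hG_diff : ∀ j, Differentiable ℂ (G j) := by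
    intro j
    refine Fin.lastCases ?_ (fun j => ?_) j
    · have h2 := ((hτf_diff.add ((hτf_diff.pow D).const_mul α)).sub (heval_diff g)).mul_const K₀⁻¹
      simp only [hG, Fin.snoc_last]
      exact h2
    · have h3 := fun i (_ : i ∈ Finset.range (κ j)) =>
        (heval_diff (A j i)).mul ((hτf_diff.const_mul (((κ j - i : ℕ) : ℂ))).neg.cexp)
      have h4 := (Differentiable.fun_sum h3).mul_const (c j)⁻¹
      simp only [hG, Fin.snoc_castSucc]
      exact h4
  -- ### bounds on the unit polydisc
  have hball : ∀ ξ ∈ ball (0 : Fin (s + 1) → ℂ) 1,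
      ‖ξ (Fin.last s)‖ ≤ 1 ∧ ‖Fin.init ξ‖ ≤ 1 := by
    intro ξ hξ
    rw [mem_ball, dist_zero_right] at hξ
    refine ⟨(norm_le_pi_norm ξ _).trans hξ.le, ?_⟩
    rw [pi_norm_le_iff_of_nonneg zero_le_one]
    intro i
    exact (norm_le_pi_norm ξ (Fin.castSucc i)).trans hξ.le
  have hτfacts : ∀ ξ ∈ ball (0 : Fin (s + 1) → ℂ) 1,
      r / 12 ≤ (τf ξ).re ∧ r / 2 ≤ ‖τf ξ‖ ∧ ‖τf ξ‖ ≤ 2 * r := by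
    intro ξ hξ
    have hη := (hball ξ hξ).1
    have e : τf ξ = (r : ℂ) * exp (θ₀ * I) * exp (ξ (Fin.last s) / D) := by
      rw [div_eq_mul_inv]
    rw [e]
    exact ⟨re_escape_ge hD hθ₀ hr0 hη, (norm_escape_le hD θ₀ hr0 hη).1,
      (norm_escape_le hD θ₀ hr0 hη).2⟩
  have hxbound : ∀ ξ ∈ ball (0 : Fin (s + 1) → ℂ) 1, 1 + ‖xf ξ‖ ≤ L * (1 + r) := by
    intro ξ hξ
    obtain ⟨-, -, hτ2⟩ := hτfacts ξ hξ
    have hζ := (hball ξ hξ).2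
    have h1 : ‖xf ξ‖ ≤ ‖τf ξ‖ * ‖κc‖ + (‖ℓ‖ + ‖Fin.init ξ‖) := by
      simp only [hxf]
      refine (norm_add_le _ _).trans (add_le_add ?_ (norm_add_le _ _))
      exact norm_smul_le _ _
    rw [hL]
    nlinarith [norm_nonneg κc, norm_nonneg ℓ, norm_nonneg (Fin.init ξ), norm_nonneg (τf ξ)]
  have hbound : ∀ j, ∀ ξ ∈ ball (0 : Fin (s + 1) → ℂ) 1, ‖G j ξ‖ ≤ ε := by
    intro j ξ hξ
    obtain ⟨hre, hτlo, hτhi⟩ := hτfacts ξ hξ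
    have hτ1 : 1 ≤ ‖τf ξ‖ := by linarith
    have hx := hxbound ξ hξ
    have hζ := (hball ξ hξ).2
    refine Fin.lastCases ?_ (fun j => ?_) j
    · -- the escaping coordinate: `‖τ + ατᴰ - g(x)‖ ≤ 2r + Cg (2+‖ℓ‖)^Ng (2r)^{D-1}`
      simp only [hG, Fin.snoc_last, hGl]
      rw [norm_mul, norm_inv, ← div_eq_mul_inv, div_le_iff₀ hK₀pos, hK₀norm']
      have hw : ‖ℓ + Fin.init ξ‖ ≤ ‖ℓ‖ + 1 := (norm_add_le _ _).trans (by linarith)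
      have hray := hCg (τf ξ) hτ1 (ℓ + Fin.init ξ)
      have hxfe : xf ξ = τf ξ • κc + (ℓ + Fin.init ξ) := rfl
      have e1 : ‖τf ξ + α * τf ξ ^ D - eval (xf ξ) g‖ ≤
          2 * r + Cg * (2 + ‖ℓ‖) ^ Ng * (2 * r) ^ (D - 1) := by
        rw [show τf ξ + α * τf ξ ^ D - eval (xf ξ) g =
            τf ξ - (eval (xf ξ) g - τf ξ ^ D * α) by ring]
        refine (norm_sub_le _ _).trans (add_le_add hτhi ?_)
        rw [hxfe]
        refine hray.trans ?_
        have e2 : (1 + ‖ℓ + Fin.init ξ‖) ^ Ng ≤ (2 + ‖ℓ‖) ^ Ng :=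
          pow_le_pow_left₀ (by positivity) (by linarith) _
        have e3 : ‖τf ξ‖ ^ (D - 1) ≤ (2 * r) ^ (D - 1) :=
          pow_le_pow_left₀ (norm_nonneg _) hτhi _
        exact mul_le_mul (mul_le_mul_of_nonneg_left e2 hCg0) e3 (by positivity) (by positivity)
      refine e1.trans ?_
      -- `2r + C (2r)^{D-1} ≤ (2 + C 2^{D-1}) r^{D-1} ≤ ε ‖α‖ r^D` since `r ≥ R₃`
      obtain ⟨D', hD'⟩ : ∃ D', D = D' + 2 := ⟨D - 2, by omega⟩
      have hDm : D - 1 = D' + 1 := by omega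
      rw [hDm, hD', mul_pow]
      have hrpow : r ≤ r ^ (D' + 1) := by
        calc r = r ^ 1 := (pow_one r).symm
          _ ≤ r ^ (D' + 1) := pow_le_pow_right₀ hr1 (by omega)
      have hR₃' : 2 + Cg * (2 + ‖ℓ‖) ^ Ng * 2 ^ (D - 1) ≤ ε * (‖α‖ * r) := by
        have := hR₃r
        rw [hR₃, div_le_iff₀ (by positivity)] at this
        linarith
      rw [hDm] at hR₃'
      have hCpos : 0 ≤ Cg * (2 + ‖ℓ‖) ^ Ng * 2 ^ (D' + 1) := by positivity
      calc 2 * r + Cg * (2 + ‖ℓ‖) ^ Ng * (2 ^ (D' + 1) * r ^ (D' + 1))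
          ≤ 2 * r ^ (D' + 1) + Cg * (2 + ‖ℓ‖) ^ Ng * (2 ^ (D' + 1) * r ^ (D' + 1)) := by
            linarith
        _ = (2 + Cg * (2 + ‖ℓ‖) ^ Ng * 2 ^ (D' + 1)) * r ^ (D' + 1) := by ring
        _ ≤ ε * (‖α‖ * r) * r ^ (D' + 1) :=
            mul_le_mul_of_nonneg_right hR₃' (by positivity)
        _ = ε * (‖α‖ * r ^ (D' + 2)) := by ring
    · -- the fibre coordinates: `Σᵢ CA (L(1+r))^{NA} e^{-r/12} / ‖c j‖ = F j r ≤ ε`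
      simp only [hG, Fin.snoc_castSucc, hGj]
      rw [norm_mul, norm_inv, ← div_eq_mul_inv]
      refine le_trans ?_ (hFε j)
      simp only [hF]
      refine div_le_div_of_nonneg_right ?_ (norm_nonneg _)
      refine (norm_sum_le _ _).trans (Finset.sum_le_sum fun i hi => ?_)
      have hi' : i < κ j := Finset.mem_range.mp hi
      rw [norm_mul]
      have e1 : ‖eval (xf ξ) (A j i)‖ ≤ CA j i * L ^ NA j i * (1 + r) ^ NA j i := by
        refine (hCA j i (xf ξ)).trans ?_
        rw [mul_assoc, ← mul_pow]
        exact mul_le_mul_of_nonneg_left (pow_le_pow_left₀ (by positivity) hx _) (hCA0 j i)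
      have e2 : ‖exp (-(((κ j - i : ℕ) : ℂ) * τf ξ))‖ ≤ Real.exp (-(r / 12)) := by
        rw [Complex.norm_exp, Real.exp_le_exp]
        simp only [Complex.neg_re, Complex.mul_re, Complex.natCast_re, Complex.natCast_im,
          zero_mul, sub_zero]
        have hm : (1 : ℝ) ≤ ((κ j - i : ℕ) : ℝ) := by
          have : 1 ≤ κ j - i := by omega
          exact_mod_cast this
        nlinarith
      calc ‖eval (xf ξ) (A j i)‖ * ‖exp (-(((κ j - i : ℕ) : ℂ) * τf ξ))‖
          ≤ (CA j i * L ^ NA j i * (1 + r) ^ NA j i) * Real.exp (-(r / 12)) :=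
            mul_le_mul e1 e2 (norm_nonneg _)
              (mul_nonneg (mul_nonneg (hCA0 j i) (pow_nonneg hL0 _)) (pow_nonneg (by linarith) _))
        _ = CA j i * L ^ NA j i * ((1 + r) ^ NA j i * Real.exp (-(r / 12))) := by ring
  -- ### the fixed point
  have hε' : 16 * ((s + 1 : ℕ) + 1 : ℝ) * ε ≤ 1 := by
    rw [hε]; push_cast
    have : (16 : ℝ) * (s + 1 + 1) * (1 / (16 * (s + 2))) = 1 := by field_simp; ring
    rw [this]
  obtain ⟨ξ, hξ, hfix⟩ :=
    Literature.NumberTheory.Transcendental.ExpDominant.exists_exp_eq_one_add G hεpos.le hε'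
      (fun j => (hG_diff j).differentiableOn) hbound
  -- ### reading off the exponential point
  set τ := τf ξ with hτdef
  set x := xf ξ with hxdef
  refine ⟨x, fun j => ?_⟩
  have hτD : α * τ ^ D = K₀ * exp (ξ (Fin.last s)) := by
    have e : τ ^ D = τ₀ ^ D * exp (ξ (Fin.last s)) := by
      have hDi : (D : ℂ) * (ξ (Fin.last s) * (D : ℂ)⁻¹) = ξ (Fin.last s) := by field_simp
      rw [hτdef]
      simp only [hτf, mul_pow, ← Complex.exp_nat_mul, hDi]
    rw [e, ← mul_assoc, hK₀eq]
  -- the last equation: `g(x) = τ + K₀`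
  have hlast := hfix (Fin.last s)
  simp only [hG, Fin.snoc_last, hGl, ← hτdef, ← hxdef] at hlast
  have hu : eval x g = τ + K₀ := by
    have hKt : ∀ t : ℂ, K₀ * (t * K₀⁻¹) = t := fun t => by field_simp
    have h1 : K₀ * exp (ξ (Fin.last s)) = K₀ + (τ + α * τ ^ D - eval x g) := by
      rw [hlast, mul_add, mul_one, hKt]
    rw [← hτD] at h1
    linear_combination h1
  have hexpu : exp (eval x g) = exp τ := by rw [hu, Complex.exp_add, hexpK₀, mul_one]
  -- the `j`-th equation
  have hj := hfix (Fin.castSucc j)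
  simp only [hG, Fin.snoc_castSucc, hGj, ← hτdef, ← hxdef] at hj
  have hxj : x j = τ * κc j + (ℓ j + ξ (Fin.castSucc j)) := by
    rw [hxdef, hτdef]
    simp only [hxf, Pi.add_apply, Pi.smul_apply, smul_eq_mul, Fin.init]
  have hpow : ∀ i ∈ Finset.range (κ j),
      exp (τ * κc j) * exp (-(((κ j - i : ℕ) : ℂ) * τ)) = exp τ ^ i := by
    intro i hi
    have hi' : i ≤ κ j := (Finset.mem_range.mp hi).le
    rw [← Complex.exp_add, ← Complex.exp_nat_mul]
    congr 1
    simp only [hκc]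
    push_cast [Nat.cast_sub hi']
    ring
  have hκpow : exp (τ * κc j) = exp τ ^ κ j := by
    rw [← Complex.exp_nat_mul]; congr 1; simp only [hκc]; ring
  have hsum : exp (τ * κc j) * ∑ i ∈ Finset.range (κ j),
      eval x (A j i) * exp (-(((κ j - i : ℕ) : ℂ) * τ)) =
        ∑ i ∈ Finset.range (κ j), eval x (A j i) * exp τ ^ i := by
    rw [Finset.mul_sum]
    refine Finset.sum_congr rfl fun i hi => ?_
    rw [← hpow i hi]; ring
  rw [hexpu]
  calc exp (x j) = exp (τ * κc j) * (exp (ℓ j) * exp (ξ (Fin.castSucc j))) := by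
        rw [hxj, Complex.exp_add, Complex.exp_add]
    _ = exp (τ * κc j) * (c j + ∑ i ∈ Finset.range (κ j),
          eval x (A j i) * exp (-(((κ j - i : ℕ) : ℂ) * τ))) := by
        have hcj := hc j
        have hct : ∀ t : ℂ, c j * (t * (c j)⁻¹) = t := fun t => by field_simp
        rw [hexpℓ, hj, mul_add, mul_one, hct]
    _ = c j * exp τ ^ κ j + ∑ i ∈ Finset.range (κ j), eval x (A j i) * exp τ ^ i := by
        rw [mul_add, hsum, hκpow]; ring

/-- **Monomial fibres** (the shape of `exists_expPoint_quadricEscape_powers`, now for every degree):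
for `g` of total degree `D ≥ 2`, `κⱼ ≥ 1` with `g_D(κ) ≠ 0`, `cⱼ ≠ 0` and arbitrary `Aⱼ ∈ ℂ[x']`, the
system `exp xⱼ = cⱼ (e^{g(x)})^{κⱼ} + Aⱼ(x)` has a solution, i.e. the `(s+1)`-fold
`{x_{s+1} = g(x'), yⱼ = cⱼ y_{s+1}^{κⱼ} + Aⱼ(x')}` meets the graph of `exp`.
[cite: MantovaMasser2023, §1 p.5 (the open case dim π(V) = 2 in ℂ³×ℂˣ³)] -/
theorem exists_expPoint_graphEscape_powers {s : ℕ} (g : MvPolynomial (Fin s) ℂ)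
    (hD : 2 ≤ g.totalDegree) (κ : Fin s → ℕ) (hκ : ∀ j, 0 < κ j)
    (hα : eval (fun j => (κ j : ℂ)) (homogeneousComponent g.totalDegree g) ≠ 0)
    (c : Fin s → ℂ) (hc : ∀ j, c j ≠ 0) (A : Fin s → MvPolynomial (Fin s) ℂ) :
    ∃ x : Fin s → ℂ, ∀ j, exp (x j) = c j * exp (eval x g) ^ (κ j) + eval x (A j) := by
  obtain ⟨x, hx⟩ := exists_expPoint_graphEscape g hD κ hα c hc
    (fun j i => if i = 0 then A j else 0)
  refine ⟨x, fun j => ?_⟩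
  rw [hx j, Finset.sum_eq_single 0]
  · simp
  · intro i _ hi; simp [hi]
  · intro h; exact absurd (Finset.mem_range.mpr (hκ j)) h

end Summit.Schanuel.Schanuel.Theorems
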